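import Literature.AlgebraicGeometry.Modules.SerreTwistThetaKer
import Literature.Algebra.Homology.SerreVanishing
import Literature.Algebra.Homology.OrderedCechMap
import Mathlib.Algebra.Homology.HomologicalComplexAbelian
import HarnessLib

/-!
# The Čech complex of the twists `G(n)` on the standard cover and the short exact sequence
# `0 → Č_n(K) → Č_n(F) → Č(𝒰; G(n)) → 0`; Serre's vanishing theorem for `Č(𝒰; G(n))`

For `ι : Z ⟶ 𝐏ʳ_A` a closed immersion, an affine-localizing `𝒪_Z`-module `G` and global sections
`g : J → Γ(Z, G(m₀))` whose chart values generate `G` on every `Z_s` (the output of Serre's theorem A), with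
`Θ`, `K = kerTheta` from `Modules/SerreTwistTheta(Ker)`:

* `SerreTwist.Theta_surjective` — `Θ_{s,n}` is surjective for `s ≠ ∅` when `ι` is a closed immersion and the
  chart values `(g_j)_{i₀}`, `i₀ ∈ s`, generate `Γ(Z_s, G)` over `Γ(Z_s, 𝒪_Z)` (the output of Serre's theorem A);
* `SerreTwist.QXM ι M p`, `dQM` — the alternating Čech cochains `Π_{i₀<⋯<i_p} Γ(Z_{i₀⋯i_p}, M)` of an
  `𝒪_Z`-module `M` on the cover `Z_i = Z ∩ D₊(x_i)` and their differential (module form of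
  `ProjCech.QX`, `ProjCech.dQ`; Stacks Project, Tag 01FG);
* `SerreTwist.qMapM` — the comparison `Č^p_n(F) → Π_σ Γ(Z_σ, G(n))`, `c ↦ (Θ_{σ,n}(c_σ))_σ`, a morphism of
  complexes (`qMapM_d`, by `Theta_res`), surjective (`Theta_surjective`), whence `dQM ∘ dQM = 0` and the
  cochain complex `SerreTwist.cechZM` of `G(n)` with the SHORT EXACT SEQUENCE `SerreTwist.sesZM n`
  (`shortExact_sesZM`: kernel `= Č_n(K)` by `Theta_eq_zero_of_mem_locDeg_ker` /
  `mem_locDeg_ker_of_Theta_eq_zero`) — the algebraic form of `0 → 𝒦 → ⊕ 𝒪_Z(-m₀) → G → 0` twisted by `n`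
  on the affine opens `Z_σ` (Hartshorne III.5, proof of Thm. 5.2);
* `SerreTwist.exists_forall_isZero_homology_cechZM` — **Serre's vanishing theorem for the Čech complexes
  of the twists**: `H^i(Č(𝒰; G(n))) = 0` for all `i ≥ 1` and `n ≥ d₀`, from the tree's algebraic Serre
  vanishing `LaurentCech.exists_forall_isZero_homology_of_shortExact`
  (`Literature/Algebra/Homology/SerreVanishing`; in negative degrees `d` the quotient complex is taken
  abstractly, `negSes`).

Everything is proved; no named facts.

References: Hartshorne III Thm. 5.2 (b) and its proof (p. 228); Serre FAC n° 66; Stacks Tag 01FG.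
[Hartshorne1977]
-/

noncomputable section

universe u

open CategoryTheory CategoryTheory.Limits AlgebraicGeometry TopologicalSpace Opposite
open Literature.Algebra.Homology Literature.Algebra.Homology.LaurentCech Literature.Algebra.Homology.OrderedCech
open Literature.AlgebraicGeometry.Morphisms Literature.AlgebraicGeometry.Morphisms.ProjCech

attribute [local instance] MvPolynomial.gradedAlgebra
  Literature.AlgebraicGeometry.Motives.ProjBaseChange.algebraBase

namespace Literature.AlgebraicGeometry.Modules

namespace SerreTwist

variable {A : Type u} [CommRing A] {r : ℕ} {Z : Scheme.{u}} (ι : Z ⟶ PP A r)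

/-! ## Alternating Čech cochains of a module on the cover `Z_i` -/

section Cochains

variable (M : Z.Modules)

/-- The `p`-cochains of `M` on the cover `(Z_i)`: a section over `Z_σ` for each `p`-simplex
`σ = {i₀ < ⋯ < i_p}`. [folklore] -/
abbrev QXM (p : ℤ) : Type u := ∀ σ : Simplex (Fin (r + 1)) p, MSections (strZ ι) M (Zop ι σ.1)

/-- A face with its restriction map `Q^p → Γ(Z_σ, M)` (zero if the face is not a simplex). [folklore] -/
def faceQM (p : ℤ) (σ : Simplex (Fin (r + 1)) (p + 1)) (a : Fin (r + 1)) :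
    QXM ι M p →ₗ[A] MSections (strZ ι) M (Zop ι σ.1) :=
  if h : (σ.1.erase a).Nonempty ∧ ((σ.1.erase a).card : ℤ) = p + 1 then
    MSections.res (strZ ι) M (Zop_mono ι (Finset.erase_subset a σ.1)) ∘ₗ
      LinearMap.proj (R := A) (φ := fun τ : Simplex (Fin (r + 1)) p => MSections (strZ ι) M (Zop ι τ.1))
        ⟨σ.1.erase a, h⟩
  else 0

/-- `faceQM` on a genuine face. [folklore] -/
theorem faceQM_apply_of {p : ℤ} (σ : Simplex (Fin (r + 1)) (p + 1)) (a : Fin (r + 1))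
    (h : (σ.1.erase a).Nonempty ∧ ((σ.1.erase a).card : ℤ) = p + 1) (c : QXM ι M p) :
    faceQM ι M p σ a c = MSections.res (strZ ι) M (Zop_mono ι (Finset.erase_subset a σ.1)) (c ⟨σ.1.erase a, h⟩) := by
  rw [faceQM, dif_pos h]; rfl

/-- `faceQM` vanishes when the face is not a simplex. [folklore] -/
theorem faceQM_apply_of_not {p : ℤ} (σ : Simplex (Fin (r + 1)) (p + 1)) (a : Fin (r + 1))
    (h : ¬((σ.1.erase a).Nonempty ∧ ((σ.1.erase a).card : ℤ) = p + 1)) (c : QXM ι M p) :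
    faceQM ι M p σ a c = 0 := by
  rw [faceQM, dif_neg h]; rfl

/-- **The Čech differential**: `(d c)_σ = Σ_{a ∈ σ} ε(σ, a) c_{σ ∖ a}|_{Z_σ}`. [folklore] -/
def dQM (p : ℤ) : QXM ι M p →ₗ[A] QXM ι M (p + 1) :=
  LinearMap.pi fun σ => ∑ a ∈ σ.1, sign A σ.1 a • faceQM ι M p σ a

/-- `dQM` unfolded. [folklore] -/
theorem dQM_apply {p : ℤ} (c : QXM ι M p) (σ : Simplex (Fin (r + 1)) (p + 1)) :
    dQM ι M p c σ = ∑ a ∈ σ.1, sign A σ.1 a • faceQM ι M p σ a c := by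
  rw [dQM, LinearMap.pi_apply, LinearMap.sum_apply]
  rfl

end Cochains

/-! ## The comparison `Č_n(F) → Č(𝒰; G(n))` -/

variable (G : Z.Modules) {J : Type} [Fintype J] (m₀ : ℕ) (g : J → Γ(twistMod ι G m₀, ⊤))

/-! ## Surjectivity of `Θ_{s,n}` for `s ≠ ∅` -/

/-- The generator `(g_j)_{i₀}` restricted to `Z_s ⊆ Z_{i₀}`. [folklore] -/
def gsec {s : Finset (Fin (r + 1))} {i₀ : Fin (r + 1)} (hi₀ : i₀ ∈ s) (j : J) : Γ(G, Zop ι s) :=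
  G.presheaf.map (homOfLE (le_inf le_top (Zop_mono ι (Finset.singleton_subset_iff.mpr hi₀)) :
    Zop ι s ≤ ⊤ ⊓ Zop ι {i₀})).op (comp ι G (g j) i₀)

/-- **`Θ_{s,n}` is surjective** (`s ≠ ∅`, `ι` a closed immersion) as soon as the restrictions
`(g_j)_{i₀}|_{Z_s}` (`i₀ ∈ s`) generate `Γ(Z_s, G)` over `Γ(Z_s, 𝒪_Z)`: write a section of `G(n)` over `Z_s`
in the chart `Z_{i₀}` as `Σ_j a_j (g_j)_{i₀}`, `a_j = b_j|_Z` with `b_j ∈ B_s`, and take `v_j = b_j x_{i₀}^{n-m₀}`.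
[folklore] -/
theorem Theta_surjective [IsClosedImmersion ι] {s : Finset (Fin (r + 1))} {i₀ : Fin (r + 1)} (hi₀ : i₀ ∈ s)
    (n : ℕ) (hgen : ∀ t : Γ(G, Zop ι s), t ∈ Submodule.span Γ(Z, Zop ι s) (Set.range (gsec ι G m₀ g hi₀))) :
    Function.Surjective (Theta ι G m₀ g s n) := by
  classical
  intro y
  have hs : s.Nonempty := ⟨i₀, hi₀⟩
  have hV : Zop ι s ≤ Zop ι {i₀} := Zop_mono ι (Finset.singleton_subset_iff.mpr hi₀)
  obtain ⟨c, hc⟩ := (Submodule.mem_span_range_iff_exists_fun _).mp (hgen (chartEquiv ι G n hV y))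
  have hb : ∀ j, ∃ b : Bsub A r s, evalRing ι s b = (show Sections (strZ ι) (Zop ι s) from c j) :=
    fun j => evalRing_surjective ι s hs _
  choose b hb using hb
  let v : J → L A r := fun j => (b j : L A r) * xs A {i₀} ((n : ℤ) - m₀)
  have hvj : ∀ j, v j ∈ Adm A r s ((n : ℤ) - m₀) := fun j => by
    have h := mul_mem_Adm (mem_Bsub_iff_mem_Adm.mp (b j).2) (xs_single_mem_Adm (A := A) hi₀ ((n : ℤ) - m₀))
    rwa [zero_add] at h
  have hv : v ∈ Floc A J m₀ s n := mem_Floc_of_forall_mem_Adm m₀ hvj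
  refine ⟨⟨v, hv⟩, (chartEquiv ι G n hV).injective ?_⟩
  rw [← hc, chartEquiv_apply, Theta_mk, comp_thetaFam, map_sum]
  refine Finset.sum_congr rfl fun j _ => ?_
  rw [Scheme.Modules.map_smul, map_gAt]
  have hfun : twFun ι s i₀ ((n : ℤ) - m₀) (v j) (mem_Adm_of_mem_locDeg (cdeg J m₀) hv j) =
      Z.presheaf.map (homOfLE (inf_le_left : Zop ι s ⊓ Zop ι {i₀} ≤ Zop ι s)).op (c j) := by
    have h := twFun_mul ι s i₀ 0 ((n : ℤ) - m₀) (b j : L A r) (xs A {i₀} ((n : ℤ) - m₀))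
      (mem_Bsub_iff_mem_Adm.mp (b j).2) (xs_single_mem_Adm (A := A) hi₀ _)
    rw [twFun_xs_single_self, mul_one, twFun_zero_deg, hb j] at h
    rw [← h]
    exact twFun_congr_deg ι s i₀ (by ring) _ _ _
  rw [hfun, IsTwistSection.map_map_apply]
  congr 1
  exact Sections.res_self (strZ ι) (c j)


variable (A r J) in
/-- The Čech family `s ↦ (F_{X_s})_n` of the free graded module `F = ⊕_j P(-m₀)`. [folklore] -/
abbrev famF (n : ℕ) (s : Finset (Fin (r + 1))) : Submodule A (J → L A r) := Floc A J m₀ s n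

/-- The Čech family `s ↦ (K_{X_s})_n` of the graded kernel. [folklore] -/
abbrev famK (n : ℕ) (s : Finset (Fin (r + 1))) : Submodule A (J → L A r) :=
  locDeg (cdeg J m₀) (kerTheta ι G m₀ g) s (n : ℤ)

omit [Fintype J] in
/-- `famF` is monotone. [folklore] -/
theorem famF_mono (n : ℕ) : Monotone (famF A r J m₀ n) :=
  locDeg_mono (cdeg J m₀) ⊤ (n : ℤ)

/-- `famK` is monotone. [folklore] -/
theorem famK_mono (n : ℕ) : Monotone (famK ι G m₀ g n) := locDeg_mono (cdeg J m₀) _ (n : ℤ)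

/-- `famK ≤ famF`. [folklore] -/
theorem famK_le_famF (n : ℕ) : ∀ s, ∀ x ∈ famK ι G m₀ g n s, LinearMap.id (R := A) x ∈ famF A r J m₀ n s :=
  fun _ _ hx => mem_Floc_of_mem_locDeg_ker ι G m₀ g hx

/-- **The comparison `Č^p_n(F) → Q^p`**: `c ↦ (Θ_{σ,n}(c_σ))_σ`. [folklore] -/
def qMapM (n : ℕ) (p : ℤ) : Cochain (famF A r J m₀ n) p →ₗ[A] QXM ι (twistMod ι G n) p where
  toFun c σ := Theta ι G m₀ g σ.1 n (c σ)
  map_add' c c' := by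
    funext σ
    rw [Pi.add_apply, ← map_add]
    rfl
  map_smul' a c := by
    funext σ
    rw [Pi.smul_apply, RingHom.id_apply, ← map_smul]
    rfl

/-- `qMapM` unfolded. [folklore] -/
theorem qMapM_apply (n : ℕ) {p : ℤ} (c : Cochain (famF A r J m₀ n) p) (σ : Simplex (Fin (r + 1)) p) :
    qMapM ι G m₀ g n p c σ = Theta ι G m₀ g σ.1 n (c σ) := rfl

/-- **`qMapM` is a morphism of complexes**: `q (d c) = d (q c)` (by `Theta_res`). [folklore] -/
theorem qMapM_d (n : ℕ) {p : ℤ} (c : Cochain (famF A r J m₀ n) p) :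
    qMapM ι G m₀ g n (p + 1) (OrderedCech.d (famF A r J m₀ n) (famF_mono m₀ n) p c) = dQM ι (twistMod ι G n) p (qMapM ι G m₀ g n p c) := by
  funext σ
  rw [dQM_apply, qMapM_apply]
  have hmem : ∀ a, c.ext0 (σ.1.erase a) ∈ famF A r J m₀ n σ.1 := fun a =>
    famF_mono m₀ n (Finset.erase_subset a σ.1) (ext0_mem c _)
  have hval : OrderedCech.d (famF A r J m₀ n) (famF_mono m₀ n) p c σ =
      ∑ a ∈ σ.1, sign A σ.1 a • (⟨c.ext0 (σ.1.erase a), hmem a⟩ : famF A r J m₀ n σ.1) := by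
    apply Subtype.ext
    rw [coe_d_apply, Submodule.coe_sum]
    rfl
  rw [hval, map_sum]
  refine Finset.sum_congr rfl fun a _ => ?_
  rw [map_smul]
  congr 1
  by_cases h : (σ.1.erase a).Nonempty ∧ ((σ.1.erase a).card : ℤ) = p + 1
  · rw [faceQM_apply_of ι _ σ a h, qMapM_apply,
      ← Theta_res ι G m₀ g (Finset.erase_subset a σ.1) n _ (c ⟨σ.1.erase a, h⟩).2]
    exact Theta_congr ι G m₀ g σ.1 n (Cochain.ext0_val c ⟨σ.1.erase a, h⟩) _ _
  · rw [faceQM_apply_of_not ι _ σ a h]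
    have h0 : c.ext0 (σ.1.erase a) = 0 := by rw [Cochain.ext0, dif_neg h]
    rw [Theta_congr ι G m₀ g σ.1 n h0 _ (Submodule.zero_mem _)]
    exact Theta_zero_mk ι G m₀ g σ.1 n _

/-- The generation hypothesis on global sections `g : J → Γ(Z, G(m₀))` — a PREDICATE on the data
`ι, G, m₀, g` (signature `Generates ι G m₀ g`), not a closed statement: the chart values `(g_j)_{i₀}` of the
generators generate `Γ(Z_s, G)` over `Γ(Z_s, 𝒪_Z)` for every `s ∋ i₀`. This is the conclusion of Serre's
theorem A on the affine pieces `Z_s`; for `ι` a closed immersion, `G` coherent and every large `m₀` such `g`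
exist by `SerreTwist.exists_generators` (`Modules/SerreTheoremA`, Hartshorne II Thm. 5.17), whose conclusion
is literally this predicate. It fails for general `g` (e.g. `g = 0` forces `Γ(Z_s, G) = 0`), so it is taken
as the hypothesis `hgen` below and has no unconditional `_holds`. (The binder `g` is written explicitly,
shadowing the section variable, so that the definition is visibly parametrised.) [folklore] -/
def Generates (g : J → Γ(twistMod ι G m₀, ⊤)) : Prop :=
  ∀ (s : Finset (Fin (r + 1))) (i₀ : Fin (r + 1)) (hi₀ : i₀ ∈ s) (t : Γ(G, Zop ι s)),
    t ∈ Submodule.span Γ(Z, Zop ι s) (Set.range (gsec ι G m₀ g hi₀))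

/-! ## Negative degrees: the abstract quotient complexes -/

/-- The inclusion of complexes `Č_d(K) → Č_d(F)` in an arbitrary degree `d ∈ ℤ`. [folklore] -/
def incl (d : ℤ) : cech (cdeg J m₀) (kerTheta ι G m₀ g) d ⟶ cech (cdeg J m₀) (⊤ : Submodule (P A r) (J → P A r)) d :=
  complexMap (F := fun s => locDeg (cdeg J m₀) (kerTheta ι G m₀ g) s d)
    (G := fun s => locDeg (cdeg J m₀) ⊤ s d) LinearMap.id
    (fun s _ hx => ⟨loc_mono_left le_top s hx.1, hx.2⟩) (locDeg_mono _ _ d) (locDeg_mono _ _ d)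

/-- The inclusion is a monomorphism of complexes. [folklore] -/
instance mono_incl (d : ℤ) : Mono (incl ι G m₀ g d) :=
  HomologicalComplex.mono_of_mono_f _ fun _ => (ModuleCat.mono_iff_injective _).mpr
    (Cochain.map_injective LinearMap.id _ fun _ _ _ h => h)

/-- The abstract quotient sequence `0 → Č_d(K) → Č_d(F) → coker → 0`. [folklore] -/
def negSes (d : ℤ) : ShortComplex (CochainComplex (ModuleCat.{u} A) ℤ) :=
  ShortComplex.mk (incl ι G m₀ g d) (cokernel.π (incl ι G m₀ g d)) (cokernel.condition _)

/-- The abstract quotient sequence is short exact. [folklore] -/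
theorem shortExact_negSes (d : ℤ) : (negSes ι G m₀ g d).ShortExact :=
  ShortComplex.ShortExact.mk' (ShortComplex.exact_cokernel _) (mono_incl ι G m₀ g d)
    (inferInstance : Epi (cokernel.π (incl ι G m₀ g d)))

variable [IsClosedImmersion ι]

/-- `qMapM` is surjective in each degree (`Θ_{σ,n}` is, `σ ≠ ∅`). [folklore] -/
theorem qMapM_surjective (hgen : Generates ι G m₀ g) (n : ℕ) (p : ℤ) : Function.Surjective (qMapM ι G m₀ g n p) := by
  intro y
  have h : ∀ σ : Simplex (Fin (r + 1)) p, ∃ x : famF A r J m₀ n σ.1, Theta ι G m₀ g σ.1 n x = y σ :=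
    fun σ => Theta_surjective ι G m₀ g (Finset.min'_mem σ.1 σ.2.1) n (hgen σ.1 _ (Finset.min'_mem σ.1 σ.2.1)) (y σ)
  choose x hx using h
  exact ⟨x, funext fun σ => hx σ⟩

/-- `dQM ∘ dQM = 0` on the cochains of `G(n)` (transported from `Č_n(F)` along the surjection `qMapM`).
[folklore] -/
theorem dQM_dQM (hgen : Generates ι G m₀ g) (n : ℕ) (p : ℤ) (c : QXM ι (twistMod ι G n) p) :
    dQM ι (twistMod ι G n) (p + 1) (dQM ι (twistMod ι G n) p c) = 0 := by
  obtain ⟨c, rfl⟩ := qMapM_surjective ι G m₀ g hgen n p c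
  rw [← qMapM_d, ← qMapM_d, OrderedCech.d_d, map_zero]

/-- **The Čech complex `Č(𝒰; G(n))` of the twist `G(n)` on the cover `Z_i = Z ∩ D₊(x_i)`**
(alternating version), a cochain complex of `A`-modules. [folklore] -/
def cechZM (hgen : Generates ι G m₀ g) (n : ℕ) : CochainComplex (ModuleCat.{u} A) ℤ :=
  CochainComplex.of (fun p => ModuleCat.of A (QXM ι (twistMod ι G n) p))
    (fun p => ModuleCat.ofHom (dQM ι (twistMod ι G n) p)) fun p =>
      ModuleCat.hom_ext (LinearMap.ext fun c => dQM_dQM ι G m₀ g hgen n p c)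

/-- The differentials of `cechZM`. [folklore] -/
theorem cechZM_d (hgen : Generates ι G m₀ g) (n : ℕ) (p : ℤ) :
    (cechZM ι G m₀ g hgen n).d p (p + 1) = ModuleCat.ofHom (dQM ι (twistMod ι G n) p) := by
  change CochainComplex.of.d (V := ModuleCat.{u} A) (fun p => ModuleCat.of A (QXM ι (twistMod ι G n) p))
    (fun p => ModuleCat.ofHom (dQM ι (twistMod ι G n) p)) p (p + 1) = _
  exact CochainComplex.of_d _ _ p

/-- The comparison morphism of complexes `Č_n(F) → Č(𝒰; G(n))`. [folklore] -/
def qHomM (hgen : Generates ι G m₀ g) (n : ℕ) :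
    cech (cdeg J m₀) (⊤ : Submodule (P A r) (J → P A r)) n ⟶ cechZM ι G m₀ g hgen n :=
  CochainComplex.ofHom (fun p => ModuleCat.ofHom (qMapM ι G m₀ g n p)) fun p => by
    change ModuleCat.ofHom (qMapM ι G m₀ g n p) ≫ (cechZM ι G m₀ g hgen n).d p (p + 1) =
      (OrderedCech.complex (famF A r J m₀ n) (famF_mono m₀ n)).d p (p + 1) ≫ ModuleCat.ofHom (qMapM ι G m₀ g n (p + 1))
    rw [cechZM_d, OrderedCech.complex_d]
    exact ModuleCat.hom_ext (LinearMap.ext fun c => (qMapM_d ι G m₀ g n c).symm)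

/-- **The short exact sequence `0 → Č_n(K) → Č_n(F) → Č(𝒰; G(n)) → 0`** as a short complex
(inclusion, then `qHomM`). [folklore] -/
def sesZM (hgen : Generates ι G m₀ g) (n : ℕ) : ShortComplex (CochainComplex (ModuleCat.{u} A) ℤ) :=
  ShortComplex.mk
    (complexMap (F := famK ι G m₀ g n) (G := famF A r J m₀ n) LinearMap.id (famK_le_famF ι G m₀ g n)
      (famK_mono ι G m₀ g n) (famF_mono m₀ n))
    (qHomM ι G m₀ g hgen n) (by
      ext p (c : Cochain (famK ι G m₀ g n) p)
      change qMapM ι G m₀ g n p (Cochain.map LinearMap.id (famK_le_famF ι G m₀ g n) p c) = 0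
      funext σ
      rw [qMapM_apply, Pi.zero_apply]
      exact Theta_eq_zero_of_mem_locDeg_ker ι G m₀ g (c σ).2)

/-- **`0 → Č_n(K) → Č_n(F) → Č(𝒰; G(n)) → 0` is short exact** for `G` affine-localizing: degreewise the
inclusion is injective, `qMapM` is surjective, and its kernel is `Č_n(K)` (`ker Θ_{s,n} = (K_{X_s})_n`).
[folklore] -/
theorem shortExact_sesZM (hG : IsAffineLocalizing G) (hgen : Generates ι G m₀ g) (n : ℕ) :
    (sesZM ι G m₀ g hgen n).ShortExact := by
  apply HomologicalComplex.shortExact_of_degreewise_shortExact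
  intro p
  apply ModuleCat.shortComplex_shortExact
  · intro (c : Cochain (famF A r J m₀ n) p)
    constructor
    · intro (hc : qMapM ι G m₀ g n p c = 0)
      have hmem : ∀ σ : Simplex (Fin (r + 1)) p, (c σ : J → L A r) ∈ famK ι G m₀ g n σ.1 := by
        intro σ
        have h0 : Theta ι G m₀ g σ.1 n (c σ) = 0 := by rw [← qMapM_apply, hc]; rfl
        exact mem_locDeg_ker_of_Theta_eq_zero ι G m₀ g hG (c σ).2 h0
      exact ⟨fun σ => ⟨(c σ : J → L A r), hmem σ⟩, funext fun σ => Subtype.ext rfl⟩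
    · rintro ⟨c', rfl⟩
      change qMapM ι G m₀ g n p (Cochain.map LinearMap.id (famK_le_famF ι G m₀ g n) p c') = 0
      funext σ
      rw [qMapM_apply, Pi.zero_apply]
      exact Theta_eq_zero_of_mem_locDeg_ker ι G m₀ g (c' σ).2
  · exact Cochain.map_injective LinearMap.id (famK_le_famF ι G m₀ g n) fun _ _ _ h => h
  · exact qMapM_surjective ι G m₀ g hgen n p

/-- The family of short exact sequences in all degrees `d ∈ ℤ`: the geometric one for `d ≥ 0`, the abstract
quotient for `d < 0`. [folklore] -/
def sesFam (hgen : Generates ι G m₀ g) : ℤ → ShortComplex (CochainComplex (ModuleCat.{u} A) ℤ)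
  | (n : ℕ) => sesZM ι G m₀ g hgen n
  | Int.negSucc k => negSes ι G m₀ g (Int.negSucc k)

/-- **Serre's vanishing theorem for the Čech complexes of the twists `G(n)`**: there is `d₀` with
`H^i(Č(𝒰; G(n))) = 0` for all `i ≥ 1` and all `n ≥ d₀` (`A` Noetherian, `ι` a closed immersion, `G`
affine-localizing, generators as in Serre's theorem A). [cite: Hartshorne1977, III Thm. 5.2 (b) p. 228 (PDF p. 284)] -/
theorem exists_forall_isZero_homology_cechZM [IsNoetherianRing A] (hG : IsAffineLocalizing G)
    (hgen : Generates ι G m₀ g) :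
    ∃ d₀ : ℕ, ∀ n : ℕ, d₀ ≤ n → ∀ i : ℤ, 1 ≤ i → IsZero ((cechZM ι G m₀ g hgen n).homology i) := by
  obtain ⟨d₀, hd₀⟩ := exists_forall_isZero_homology_of_shortExact (cdeg J m₀) (isGraded_kerTheta ι G m₀ g)
    (sesFam ι G m₀ g hgen) (fun d => by
      cases d with
      | ofNat n => exact shortExact_sesZM ι G m₀ g hG hgen n
      | negSucc k => exact shortExact_negSes ι G m₀ g (Int.negSucc k))
    (fun d => by cases d <;> rfl) (fun d => by cases d <;> rfl)
  refine ⟨d₀.toNat, fun n hn i hi => ?_⟩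
  exact hd₀ (n : ℤ) (by omega) i hi

end SerreTwist

end Literature.AlgebraicGeometry.Modules

end
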